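/- Free-seat work of EXTRA WIDTH SEAT `ym-line-cbag-p1-w5` (prover-ym-line-cbag-p1-w5-g3-0), route `EguchiKawaiDirectionLadder`
(ideator ym-idea-2, LINE 8), crux `TripleSmallBallMargin` (stmt-QuantumFields-27724), v7 S10-C glue: the RELABELLING BRIDGE from the
`Option (Fin m)`-valued block labelling of `blocks_from_pair_profile` (`none` = collar) to the `Fin (m+1)`-valued labelling (collar =
`Fin.last m`, blocks = `Fin.castSucc c`) used by the pair-product partition (`…PairPartition`) and by the one-level decoupling capstone;
with the count of labelled cross pairs converted from ORDERED pairs to INCREASING pairs.  Pure bookkeeping, ROUTE-INDEPENDENT.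
Nothing here bears on the Yang–Mills mass gap. -/
import Summits.QuantumFields.YangMills.Theorems.EguchiKawaiDirectionLadderProfileBlocks
import Summits.QuantumFields.YangMills.Theorems.EguchiKawaiDirectionLadderHaarOffDiagSmallBall
import Mathlib.Logic.Equiv.Fin.Basic
import HarnessLib

/-!
# Route `EguchiKawaiDirectionLadder`: relabelling blocks `Option (Fin m) → Fin (m+1)` and counting cross pairs

For `ℓ : Fin N → Option (Fin m)` put `ℓ' := finSuccEquivLast.symm ∘ ℓ : Fin N → Fin (m+1)` (`some c ↦ castSucc c`, `none ↦ last`).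

* `relabel_eq_last_iff`, `relabel_eq_castSucc_iff`, `relabel_eq_relabel_iff`, `relabel_ne_last_iff` — the dictionary;
  `card_relabel_castSucc`, `card_relabel_last`, `card_relabel_last_add` — block sizes and the collar count (`|K| = N − #labelled`);
* `card_filter_pairs_eq_two_mul` — for a symmetric irreflexive pair predicate, `#{ordered pairs} = 2 · #{increasing pairs}` (finsets of
  `Fin N × Fin N`); hence `card_crossPairs_eq_two_mul` for the labelled cross pairs;
* `blocks_from_pair_profile_fin` — w2's `blocks_from_pair_profile` restated with a `Fin (m+1)` labelling: separation `γ` across distinct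
  non-collar labels, `ρ`-closeness inside each block `castSucc c`, collar count `≤ N/M`, and the INCREASING labelled cross pair count
  `X' ≥ ((N − N/M)² − #{ρ-close ordered pairs}) / 2` (the `Option` labelling `ℓ` is kept alongside, `ℓ' = finSuccEquivLast.symm ∘ ℓ`,
  because the off-block small-ball bound is stated for it);
* `labelPairCount_eq_two_mul_crossPairs`, `haar_offDiagBlockSq_le_pow_crossPairs` — w3's `haar_offDiagBlockSq_smallBall` with the exponent
  written as the increasing cross-pair count: `Haar{offDiagBlockSq ℓ W ≤ N s} ≤ e^{C_m N²} · s^{X'}`.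

HONEST FRAMING: bookkeeping only.  The route bears on the barrier-ledger fact `EguchiKawaiBreakdown`; the Yang–Mills mass gap is
NOT touched.
-/

set_option autoImplicit false

open Finset MeasureTheory
open scoped ENNReal
open Literature.Barriers.QuantumFields
open Literature.MathematicalPhysics.QuantumFieldTheory (haarProbability)

namespace Summit.QuantumFields.YangMills.Theorems.EguchiKawaiDirectionLadder

namespace BlockRelabel

variable {N m : ℕ}

/-! ### §1 The dictionary `Option (Fin m) ↔ Fin (m+1)` -/

/-- `ℓ' i = last ↔ ℓ i = none`. -/
theorem relabel_eq_last_iff (o : Option (Fin m)) : finSuccEquivLast.symm o = Fin.last m ↔ o = none := by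
  rw [← finSuccEquivLast_symm_none, finSuccEquivLast.symm.injective.eq_iff]

/-- `ℓ' i = castSucc c ↔ ℓ i = some c`. -/
theorem relabel_eq_castSucc_iff (o : Option (Fin m)) (c : Fin m) :
    finSuccEquivLast.symm o = Fin.castSucc c ↔ o = some c := by
  rw [← finSuccEquivLast_symm_some, finSuccEquivLast.symm.injective.eq_iff]

/-- `ℓ' j = ℓ' k ↔ ℓ j = ℓ k`. -/
theorem relabel_eq_relabel_iff (o o' : Option (Fin m)) : finSuccEquivLast.symm o = finSuccEquivLast.symm o' ↔ o = o' :=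
  finSuccEquivLast.symm.injective.eq_iff

/-- `ℓ' i ≠ last ↔ ℓ i ≠ none`. -/
theorem relabel_ne_last_iff (o : Option (Fin m)) : finSuccEquivLast.symm o ≠ Fin.last m ↔ o ≠ none :=
  (relabel_eq_last_iff o).not

/-- Block sizes: `#{ℓ' = castSucc c} = #{ℓ = some c}`. -/
theorem card_relabel_castSucc (ℓ : Fin N → Option (Fin m)) (c : Fin m) :
    (univ.filter fun i => finSuccEquivLast.symm (ℓ i) = Fin.castSucc c).card = (univ.filter fun i => ℓ i = some c).card := by
  congr 1; ext i; simp only [mem_filter, mem_univ, true_and, relabel_eq_castSucc_iff]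

/-- Collar count: `#{ℓ' = last} = #{ℓ = none}`. -/
theorem card_relabel_last (ℓ : Fin N → Option (Fin m)) :
    (univ.filter fun i => finSuccEquivLast.symm (ℓ i) = Fin.last m).card = (univ.filter fun i => ℓ i = none).card := by
  congr 1; ext i; simp only [mem_filter, mem_univ, true_and, relabel_eq_last_iff]

/-- `#{ℓ' = last} + #{ℓ ≠ none} = N`. -/
theorem card_relabel_last_add (ℓ : Fin N → Option (Fin m)) :
    (univ.filter fun i => finSuccEquivLast.symm (ℓ i) = Fin.last m).card + (univ.filter fun k => ℓ k ≠ none).card = N := by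
  rw [card_relabel_last]
  have h := card_filter_add_card_filter_not (s := (univ : Finset (Fin N))) (fun k => ℓ k = none)
  rw [card_univ, Fintype.card_fin] at h
  exact h

/-- Collar count in `ℝ`: `#{ℓ' = last} = N − #{ℓ ≠ none}`; so `#labelled ≥ N − N/M` gives `#{ℓ' = last} ≤ N/M`. -/
theorem card_relabel_last_le (ℓ : Fin N → Option (Fin m)) {B : ℝ}
    (h : (N : ℝ) - B ≤ ((univ.filter fun k => ℓ k ≠ none).card : ℝ)) :
    ((univ.filter fun i => finSuccEquivLast.symm (ℓ i) = Fin.last m).card : ℝ) ≤ B := by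
  have hsum : ((univ.filter fun i => finSuccEquivLast.symm (ℓ i) = Fin.last m).card : ℝ) +
      ((univ.filter fun k => ℓ k ≠ none).card : ℝ) = N := by exact_mod_cast card_relabel_last_add ℓ
  linarith

/-! ### §2 Ordered versus increasing pairs -/

/-- **`#{ordered} = 2 · #{increasing}`** for a symmetric irreflexive pair predicate on `Fin N`. -/
theorem card_filter_pairs_eq_two_mul (P : Fin N → Fin N → Prop) [DecidableRel P] (hsymm : ∀ j k, P j k → P k j)
    (hirr : ∀ j, ¬ P j j) :
    ((univ : Finset (Fin N × Fin N)).filter (fun p => P p.1 p.2)).card =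
      2 * ((univ : Finset (Fin N × Fin N)).filter (fun p => p.1 < p.2 ∧ P p.1 p.2)).card := by
  set S := (univ : Finset (Fin N × Fin N)).filter (fun p => P p.1 p.2) with hS
  set A := (univ : Finset (Fin N × Fin N)).filter (fun p => p.1 < p.2 ∧ P p.1 p.2) with hA
  set B := (univ : Finset (Fin N × Fin N)).filter (fun p => p.2 < p.1 ∧ P p.1 p.2) with hB
  have hsplit : S = A ∪ B := by
    ext p
    simp only [hS, hA, hB, mem_filter, mem_univ, true_and, mem_union]
    constructor
    · intro hp
      have hne : p.1 ≠ p.2 := fun h => hirr p.1 (by simpa [← h] using hp)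
      rcases lt_or_gt_of_ne hne with h | h
      · exact Or.inl ⟨h, hp⟩
      · exact Or.inr ⟨h, hp⟩
    · rintro (⟨-, hp⟩ | ⟨-, hp⟩) <;> exact hp
  have hdisj : Disjoint A B := by
    rw [disjoint_left]
    intro p hpA hpB
    simp only [hA, hB, mem_filter, mem_univ, true_and] at hpA hpB
    exact absurd (hpA.1.trans hpB.1) (lt_irrefl _)
  -- the swap is a bijection `A → B`
  have hswap : B = A.map (Equiv.prodComm (Fin N) (Fin N)).toEmbedding := by
    ext p
    simp only [hA, hB, mem_map_equiv, mem_filter, mem_univ, true_and]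
    change _ ↔ (p.2 < p.1 ∧ P p.2 p.1)
    constructor
    · rintro ⟨h, hp⟩; exact ⟨h, hsymm _ _ hp⟩
    · rintro ⟨h, hp⟩; exact ⟨h, hsymm _ _ hp⟩
  rw [hsplit, card_union_of_disjoint hdisj, hswap, card_map]
  ring

/-- The labelled cross pair predicate of a `Fin (m+1)` labelling is symmetric and irreflexive, so its ordered count is twice
its increasing count. -/
theorem card_crossPairs_eq_two_mul (ℓ' : Fin N → Fin (m + 1)) :
    ((univ : Finset (Fin N × Fin N)).filter
        (fun p => ℓ' p.1 ≠ ℓ' p.2 ∧ ℓ' p.1 ≠ Fin.last m ∧ ℓ' p.2 ≠ Fin.last m)).card =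
      2 * ((univ : Finset (Fin N × Fin N)).filter
        (fun p => p.1 < p.2 ∧ ℓ' p.1 ≠ ℓ' p.2 ∧ ℓ' p.1 ≠ Fin.last m ∧ ℓ' p.2 ≠ Fin.last m)).card :=
  card_filter_pairs_eq_two_mul (fun j k => ℓ' j ≠ ℓ' k ∧ ℓ' j ≠ Fin.last m ∧ ℓ' k ≠ Fin.last m)
    (fun _ _ h => ⟨fun hh => h.1 hh.symm, h.2.2, h.2.1⟩) (fun _ h => h.1 rfl)

/-- The ordered labelled cross count of an `Option` labelling equals that of its relabelling. -/
theorem card_crossPairs_relabel (ℓ : Fin N → Option (Fin m)) :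
    ((univ : Finset (Fin N × Fin N)).filter (fun p => ℓ p.1 ≠ ℓ p.2 ∧ ℓ p.1 ≠ none ∧ ℓ p.2 ≠ none)).card =
      ((univ : Finset (Fin N × Fin N)).filter (fun p =>
        finSuccEquivLast.symm (ℓ p.1) ≠ finSuccEquivLast.symm (ℓ p.2) ∧
          finSuccEquivLast.symm (ℓ p.1) ≠ Fin.last m ∧ finSuccEquivLast.symm (ℓ p.2) ≠ Fin.last m)).card := by
  congr 1; ext p
  simp only [mem_filter, mem_univ, true_and, ne_eq, relabel_eq_relabel_iff, relabel_eq_last_iff]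

/-- The ordered labelled cross count of an `Option` labelling is twice the increasing labelled cross count of its relabelling. -/
theorem card_crossPairs_relabel_two_mul (ℓ : Fin N → Option (Fin m)) :
    ((univ : Finset (Fin N × Fin N)).filter (fun p => ℓ p.1 ≠ ℓ p.2 ∧ ℓ p.1 ≠ none ∧ ℓ p.2 ≠ none)).card =
      2 * ((univ : Finset (Fin N × Fin N)).filter (fun p => p.1 < p.2 ∧
        finSuccEquivLast.symm (ℓ p.1) ≠ finSuccEquivLast.symm (ℓ p.2) ∧
          finSuccEquivLast.symm (ℓ p.1) ≠ Fin.last m ∧ finSuccEquivLast.symm (ℓ p.2) ≠ Fin.last m)).card := by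
  rw [card_crossPairs_relabel]
  exact card_crossPairs_eq_two_mul (fun i => finSuccEquivLast.symm (ℓ i))

/-! ### §3 `blocks_from_pair_profile` with a `Fin (m+1)` labelling -/

/-- **Block labels from a pair profile, `Fin (m+1)` form.**  For `0 < ρ` and `M ≥ 2` there are `m` and `γ > 0` such that every
unit-modulus family `d : Fin N → ℂ` admits a labelling `ℓ' : Fin N → Fin (m+1)` (collar label `Fin.last m`) with
(i) `γ`-separation across distinct non-collar labels, (ii) `ρ`-closeness inside each block `castSucc c`, (iii) at most `N/M` collar
indices, (iv) at least `((N − N/M)² − #{(j,k) : |d_j − d_k| ≤ ρ}) / 2` INCREASING labelled cross pairs. -/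
theorem blocks_from_pair_profile_fin (ρ : ℝ) (hρ : 0 < ρ) (M : ℕ) (hM : 2 ≤ M) :
    ∃ m : ℕ, ∃ γ : ℝ, 0 < γ ∧ ∀ N : ℕ, ∀ d : Fin N → ℂ, (∀ j, ‖d j‖ = 1) →
      ∃ ℓ' : Fin N → Fin (m + 1),
        (∀ j k, ℓ' j ≠ ℓ' k → ℓ' j ≠ Fin.last m → ℓ' k ≠ Fin.last m → γ ≤ ‖d j - d k‖ ^ 2) ∧
        (∀ j k (c : Fin m), ℓ' j = Fin.castSucc c → ℓ' k = Fin.castSucc c → ‖d j - d k‖ ≤ ρ) ∧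
        ((univ.filter fun i => ℓ' i = Fin.last m).card : ℝ) ≤ N / M ∧
        (((N : ℝ) - N / M) ^ 2 - ((univ.filter fun p : Fin N × Fin N => ‖d p.1 - d p.2‖ ≤ ρ).card : ℝ)) / 2 ≤
          (((univ : Finset (Fin N × Fin N)).filter
            (fun p => p.1 < p.2 ∧ ℓ' p.1 ≠ ℓ' p.2 ∧ ℓ' p.1 ≠ Fin.last m ∧ ℓ' p.2 ≠ Fin.last m)).card : ℝ) := by
  obtain ⟨m, γ, hγ, h⟩ := blocks_from_pair_profile ρ hρ M hM
  refine ⟨m, γ, hγ, fun N d hd => ?_⟩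
  obtain ⟨ℓ, hsep, hclose, hcount, hcross⟩ := h N d hd
  refine ⟨fun i => finSuccEquivLast.symm (ℓ i), ?_, ?_, card_relabel_last_le ℓ hcount, ?_⟩
  · intro j k hne hj hk
    beta_reduce at hne hj hk
    exact hsep j k (fun hh => hne (by rw [hh])) ((relabel_ne_last_iff _).1 hj) ((relabel_ne_last_iff _).1 hk)
  · intro j k c hj hk
    beta_reduce at hj hk
    exact hclose j k c ((relabel_eq_castSucc_iff _ _).1 hj) ((relabel_eq_castSucc_iff _ _).1 hk)
  · beta_reduce
    rw [card_crossPairs_relabel_two_mul ℓ] at hcross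
    push_cast at hcross
    linarith


/-- **Block labels from a pair profile, keeping the `Option` labelling** (for the off-block small-ball bound) together with the
properties of its relabelling `ℓ' = finSuccEquivLast.symm ∘ ℓ`. -/
theorem blocks_from_pair_profile_relabel (ρ : ℝ) (hρ : 0 < ρ) (M : ℕ) (hM : 2 ≤ M) :
    ∃ m : ℕ, ∃ γ : ℝ, 0 < γ ∧ ∀ N : ℕ, ∀ d : Fin N → ℂ, (∀ j, ‖d j‖ = 1) →
      ∃ ℓ : Fin N → Option (Fin m),
        (∀ j k, ℓ j ≠ ℓ k → ℓ j ≠ none → ℓ k ≠ none → γ ≤ ‖d j - d k‖ ^ 2) ∧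
        (∀ j k (c : Fin m), finSuccEquivLast.symm (ℓ j) = Fin.castSucc c → finSuccEquivLast.symm (ℓ k) = Fin.castSucc c →
          ‖d j - d k‖ ≤ ρ) ∧
        ((univ.filter fun i => finSuccEquivLast.symm (ℓ i) = Fin.last m).card : ℝ) ≤ N / M ∧
        (((N : ℝ) - N / M) ^ 2 - ((univ.filter fun p : Fin N × Fin N => ‖d p.1 - d p.2‖ ≤ ρ).card : ℝ)) / 2 ≤
          (((univ : Finset (Fin N × Fin N)).filter (fun p => p.1 < p.2 ∧
            finSuccEquivLast.symm (ℓ p.1) ≠ finSuccEquivLast.symm (ℓ p.2) ∧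
              finSuccEquivLast.symm (ℓ p.1) ≠ Fin.last m ∧ finSuccEquivLast.symm (ℓ p.2) ≠ Fin.last m)).card : ℝ) := by
  obtain ⟨m, γ, hγ, h⟩ := blocks_from_pair_profile ρ hρ M hM
  refine ⟨m, γ, hγ, fun N d hd => ?_⟩
  obtain ⟨ℓ, hsep, hclose, hcount, hcross⟩ := h N d hd
  refine ⟨ℓ, hsep, ?_, card_relabel_last_le ℓ hcount, ?_⟩
  · intro j k c hj hk
    exact hclose j k c ((relabel_eq_castSucc_iff _ _).1 hj) ((relabel_eq_castSucc_iff _ _).1 hk)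
  · rw [card_crossPairs_relabel_two_mul ℓ] at hcross
    push_cast at hcross
    linarith

/-! ### §4 The off-block small-ball bound with the increasing cross-pair count -/

/-- `labelPairCount ℓ = 2 · X'` with `X'` the increasing labelled cross-pair count of the relabelling. -/
theorem labelPairCount_eq_two_mul_crossPairs (ℓ : Fin N → Option (Fin m)) :
    labelPairCount ℓ =
      2 * ((univ : Finset (Fin N × Fin N)).filter (fun p => p.1 < p.2 ∧
        finSuccEquivLast.symm (ℓ p.1) ≠ finSuccEquivLast.symm (ℓ p.2) ∧
          finSuccEquivLast.symm (ℓ p.1) ≠ Fin.last m ∧ finSuccEquivLast.symm (ℓ p.2) ≠ Fin.last m)).card := by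
  unfold labelPairCount
  exact card_crossPairs_relabel_two_mul ℓ

/-- **Off-block small ball, increasing-count exponent**: for every `m` there is `C_m ≥ 0` with
`Haar{W : offDiagBlockSq ℓ W ≤ N s} ≤ exp(C_m N²) · s^{X'}` for all `N`, all `ℓ : Fin N → Option (Fin m)`, `0 < s ≤ 1`, where `X'` is the
number of increasing labelled cross pairs (width seat w3's `HaarColumns.haar_offDiagBlockSq_smallBall`, exponent rewritten). -/
theorem haar_offDiagBlockSq_le_pow_crossPairs (m : ℕ) :
    ∃ Cm : ℝ, 0 ≤ Cm ∧ ∀ N : ℕ, ∀ ℓ : Fin N → Option (Fin m), ∀ s : ℝ, 0 < s → s ≤ 1 →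
      haarProbability (UN N) {W : UN N | offDiagBlockSq ℓ (W : Matrix (Fin N) (Fin N) ℂ) ≤ N * s} ≤
        ENNReal.ofReal (Real.exp (Cm * (N : ℝ) ^ 2) *
          s ^ ((univ : Finset (Fin N × Fin N)).filter (fun p => p.1 < p.2 ∧
            finSuccEquivLast.symm (ℓ p.1) ≠ finSuccEquivLast.symm (ℓ p.2) ∧
              finSuccEquivLast.symm (ℓ p.1) ≠ Fin.last m ∧ finSuccEquivLast.symm (ℓ p.2) ≠ Fin.last m)).card) := by
  obtain ⟨Cm, hCm, h⟩ := HaarColumns.haar_offDiagBlockSq_smallBall m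
  refine ⟨Cm, hCm, fun N ℓ s hs hs1 => ?_⟩
  have h' := h N ℓ s hs hs1
  have hexp : ((labelPairCount ℓ : ℕ) : ℝ) / 2 =
      (((univ : Finset (Fin N × Fin N)).filter (fun p => p.1 < p.2 ∧
        finSuccEquivLast.symm (ℓ p.1) ≠ finSuccEquivLast.symm (ℓ p.2) ∧
          finSuccEquivLast.symm (ℓ p.1) ≠ Fin.last m ∧ finSuccEquivLast.symm (ℓ p.2) ≠ Fin.last m)).card : ℝ) := by
    rw [labelPairCount_eq_two_mul_crossPairs]; push_cast; ring
  rw [hexp, Real.rpow_natCast] at h'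
  exact h'

end BlockRelabel

end Summit.QuantumFields.YangMills.Theorems.EguchiKawaiDirectionLadder
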